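import Summits.KontsevichZagierPeriods.KontsevichZagierPeriods.Theorems.UnfoldedStokesDefs
import Literature.NumberTheory.Transcendental.KZSemialgebraicComplex

/-!
# `StokesGeneration` (stmt-KontsevichZagierPeriods-3586), line `fibrewise_stokes` — closure properties of the S2 class, II: algebraic scalars

The class `FibStokesDecomposable M h` (route definition, `Theorems/UnfoldedStokesDefs.lean`) is stable under
multiplication by a REAL ALGEBRAIC constant `c` (scale every primitive, derivative and carried representation by `c`
(the scaled representation is built inline, no new definition);
`ℚ`-semialgebraicity of `c·G` needs `c` algebraic — a transcendental scalar would leave the Kontsevich–Zagier calculus).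
With `fibStokesDecomposable_zero`, `_neg` (file I) and `_add` this makes the class a module over `ℚ̄ ∩ ℝ` acting on
admissible integrands. Pure bookkeeping.

References: J. Ayoub, Ann. of Math. 181 (2015), Rem. 1.5; M. Kontsevich, D. Zagier, *Periods* (2001), §1.1–1.2.
-/

noncomputable section

set_option linter.dupNamespace false

namespace Summit.KontsevichZagierPeriods.KontsevichZagierPeriods.Cruxes.StokesGeneration.FibrewiseStokes

open MeasureTheory Set
open Literature.NumberTheory.Transcendental
open Literature.NumberTheory.Transcendental.KZ
open Literature.ModelTheory.ExponentialFields (IsSemialgebraic)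

/-- **Algebraic scalars (registered stub `fibStokesDecomposable_const_mul`).** The class of fibrewise-Stokes
decomposable functions is stable under `h ↦ c·h` for a real algebraic constant `c`. [folklore] -/
theorem fibStokesDecomposable_const_mul : ∀ (M : ℕ) (c : ℝ) (h : (Fin M → ℝ) → ℝ), IsAlgebraic ℚ c → FibStokesDecomposable M h → FibStokesDecomposable M (fun x => c * h x) := by
  intro M c h hc ⟨M', hMM', J, i, G, D, K, q, Z, hpack, hq, hZs, hZ0, hid⟩
  have hSsa : IsSemialgebraic ℚ (Set.pi Set.univ (fun _ : Fin M' => Set.Icc (0:ℝ) 1)) := by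
    rw [← cube_eq_pi]; exact isSemialgebraic_cube
  have hcsa : IsSemialgebraicFunOn ℚ (Set.pi Set.univ (fun _ : Fin M' => Set.Icc (0:ℝ) 1)) (fun _ => c) :=
    isSemialgebraicFunOn_const_of_isAlgebraic hSsa hc
  refine ⟨M', hMM', J, i, fun j x => c * G j x, fun j x => c * D j x, K, fun j =>
      { domain := (q j).domain
        integrand := fun x => c * (q j).integrand x
        isSemialgebraic_domain := (q j).isSemialgebraic_domain
        isSemialgebraicFunOn_integrand :=
          (isSemialgebraicFunOn_const_of_isAlgebraic (q j).isSemialgebraic_domain hc).fun_mul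
            (q j).isSemialgebraicFunOn_integrand
        integrableOn := (q j).integrableOn.const_mul c }, Z,
    fun j => ?_, fun j => ⟨(hq j).1, fun x hx => ?_⟩, hZs, hZ0, fun x hx hxZ => ?_⟩
  · obtain ⟨h1, h2, h3, ⟨B, hB⟩, h5, h6, h7⟩ := hpack j
    refine ⟨hcsa.fun_mul h1, hcsa.fun_mul h2, h3, ⟨|c| * B, fun x hx => ?_⟩, h5,
      fun x hx => continuousOn_const.mul (h6 x hx), fun x hx hxK hxj => (h7 x hx hxK hxj).const_mul c⟩
    rw [abs_mul]
    exact mul_le_mul_of_nonneg_left (hB x hx) (abs_nonneg c)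
  · show c * (q j).integrand x = _
    rw [(hq j).2 x hx]; ring
  · show c * h (fun l => x (Fin.castLE hMM' l)) = ∑ j, c * (q j).integrand x
    rw [hid x hx hxZ, Finset.mul_sum]

end Summit.KontsevichZagierPeriods.KontsevichZagierPeriods.Cruxes.StokesGeneration.FibrewiseStokes

end
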